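import Literature.AlgebraicGeometry.Shioda1982.ExceptionalQuadruples
import Literature.AlgebraicGeometry.HodgeTheory.FermatFourfoldFiveStandardSextuples
import HarnessLib

/-!
# Shioda 1982, Lemma 1: the standard elements `αᵢ = (i, m′+i, m−2i, m′)` (`m = 2m′`) and `γ₁` (`3 ∣ m`) of `𝔅²ₘ` are (indecomposable) Hodge quadruples

Topic `Literature/AlgebraicGeometry/Shioda1982`, companion to `ExceptionalQuadruples.lean` (which defines the Standardquadrupel
`stdOne m = L₁ = (1, K, K+1, 2K−2)`, `m = 2K`, of [MeyerNeutsch1981Fermatquadrupel, (13)] = Shioda's `α₁` up to order, and checks it at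
`m = 12` by `decide`). THEOREMS for general `m`, no definition, no named fact:

* `isHodgeMultiset_alpha` — [Shioda1982PicardFermat, Lemma 1 (a), p. 728], the part "`αᵢ ∈ 𝔅²ₘ`": for `m = 2K` and `a ∈ ℤ/m` with
  `a ∉ {0, K}` the quadruple `{a, K, K + a, 2K − 2a} = (a, m′+a, m−2a, m′)` is a Hodge multiset (Shioda's equations (2):
  `Σ ⟨t x⟩ = 2m` for every unit `t`). PROOF (the printed "easy verification", spelled out): a unit `t` of `ℤ/2K` is odd, so `t·K = K`
  (`unit_mul_natCast_half`); with `y = ⟨ta⟩ ∉ {0, K}` the four representatives are `y, K, K + y, 2K − 2y` if `y < K` and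
  `y, K, y − K, 4K − 2y` if `y > K`, of sum `4K = 2m` either way (`norm_alpha`).
* `isHodgeMultiset_stdOne`, `card_stdOne`, `one_mem_stdOne`, `neg_one_not_mem_stdOne`, `not_exists_eq_pairs_stdOne` — the instance
  `a = 1`, i.e. `L₁ = α₁`, for even `m ≥ 6` (Shioda's range `1 ≤ i ≤ m′−1`, `i ≠ m′/2` at `i = 1` means `m′ ≥ 3`): `L₁` is a Hodge
  quadruple containing `1` and not `−1`, hence NOT of the form `{a, −a} + {b, −b}` — "indecomposable" in the sense of
  [Shioda1982PicardFermat, §2 p. 726] (`aᵢ + aⱼ ≢ 0` for `i ≠ j`), in the shape used by the cell's `ConditionQSymmetric` files.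
* `stdThree_eq_pStandard`, `isHodgeMultiset_stdThree` — [Shioda1982PicardFermat, Lemma 1 (b), p. 728], the part "`γ₁ ∈ 𝔅²ₘ`" for
  `L₃ = γ₁ = (1, m″+1, 2m″+1, m−3)`, `3 ∣ m`, `m > 3`: `L₃` is the multiset of Aoki's `σ_{3,1} = (1, 1+d, 1+2d, −3)`, `d = m/3`, which is
  Hodge by the tree's `isHodgeMultiset_pStandard` ([Aoki1983, Prop. 5.1]).
* `isHodgeMultiset_beta`, `isHodgeMultiset_stdTwo` (appended) — [Shioda1982PicardFermat, Lemma 1 (a)], the part "`βᵢ ∈ 𝔅²ₘ`": for `m = 2K`,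
  `a ∉ {0, K}`, `2a ≠ K`, the quadruple `{a, K + a, K + 2a, −4a} = βᵢ = (i, m′+i, m′+2i, m−4i)` is Hodge, by cancellation from the
  multiset identity `αₐ + α₂ₐ = {K, K} + {2a, −2a} + βₐ`; instance `L₂ = β₁` for even `m ≥ 6`.
Scope of this file: `αᵢ`, `βᵢ` (general `i`), `α₁ = L₁`, `β₁ = L₂`, `γ₁ = L₃`; not treated: `γⱼ` for `j > 1` (these are Aoki's `σ_{3,j}`,
Hodge by the tree's `isHodgeMultiset_pStandard`), the indecomposability of `βᵢ`, `γ₁` (for `m ≥ 9` it follows as for `L₁`: `1 ∈ L₃`, `−1 ∉ L₃`),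
and the membership in `𝔍²ₘ(1)` ("iff `GCD(i, m′) = 1`").

HONEST FRAMING (cell `pub-hfermat`): explicit algebraic cycles for specific Hodge classes on Fermat/Delsarte varieties; residual open
instances listed; no claim on general Hodge. (These surface classes are algebraic — Lefschetz (1,1); the lemma is used by the cell only to
delimit the scope of a hypothesis: `Summits/…/FermatCycles/ConditionQKoblitzRohrlich.lean`.)

## References
* [Shioda1982PicardFermat] T. Shioda, *On the Picard number of a Fermat surface*, J. Fac. Sci. Univ. Tokyo IA 28 (1982) 725–734: §2 p. 726
  (decomposable), Lemma 1 (a) p. 728 (page image read, `HOME/lit/scans/Shioda1982/page04.png`).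
* [MeyerNeutsch1981Fermatquadrupel] W. Meyer, W. Neutsch, *Fermatquadrupel*, Math. Ann. 256 (1981) 51–62: (13), (15) p. 53 (`L₁`, `L₃`).
* [Aoki1983] N. Aoki, Math. Ann. 266 (1983) 23–54, §5 Prop. 5.1 p. 36 (standard elements are Hodge).
-/

namespace Literature.AlgebraicGeometry.Shioda1982

open Multiset
open Literature.AlgebraicGeometry.HodgeTheory Literature.AlgebraicGeometry.HodgeTheory.FermatCharacter

variable {m K : ℕ}

/-! ### Arithmetic in `ℤ/2K` -/

/-- `K + K = 0` in `ℤ/2K`. [folklore] -/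
private theorem natCast_half_add_self (hm : m = 2 * K) : ((K : ℕ) : ZMod m) + K = 0 := by
  rw [← Nat.cast_add, ← two_mul, ← hm, ZMod.natCast_self]

/-- `⟨K⟩ = K` in `ℤ/2K`, `K > 0`. [folklore] -/
private theorem val_natCast_half [NeZero m] (hm : m = 2 * K) : ((K : ℕ) : ZMod m).val = K := by
  rw [ZMod.val_natCast]
  have := NeZero.ne m
  exact Nat.mod_eq_of_lt (by omega)

/-- `K ≠ 0` in `ℤ/2K`, `K > 0`. [folklore] -/
private theorem natCast_half_ne_zero [NeZero m] (hm : m = 2 * K) : ((K : ℕ) : ZMod m) ≠ 0 := fun h ↦ by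
  have h' := congrArg ZMod.val h
  rw [val_natCast_half hm, ZMod.val_zero] at h'
  have := NeZero.ne m
  omega

/-- A unit `t` of `ℤ/2K` is odd, so `t · K = K`. [cite: Shioda1982PicardFermat, Lemma 1 (a) p. 728 (the entry m′ of αᵢ is fixed by (ℤ/m)ˣ)] -/
theorem unit_mul_natCast_half [NeZero m] (hm : m = 2 * K) (t : (ZMod m)ˣ) : (t : ZMod m) * K = K := by
  have hcop := ZMod.val_coe_unit_coprime t
  have hodd : (t : ZMod m).val % 2 = 1 := by
    by_contra h
    have h2 : 2 ∣ (t : ZMod m).val := Nat.dvd_of_mod_eq_zero (by omega)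
    have := Nat.dvd_gcd h2 (show 2 ∣ m from ⟨K, hm⟩)
    rw [Nat.Coprime.gcd_eq_one hcop] at this
    exact absurd (Nat.le_of_dvd one_pos this) (by norm_num)
  obtain ⟨q, hq⟩ : ∃ q, (t : ZMod m).val = 2 * q + 1 := ⟨(t : ZMod m).val / 2, by omega⟩
  calc (t : ZMod m) * K = (((t : ZMod m).val : ℕ) : ZMod m) * K := by rw [ZMod.natCast_zmod_val]
    _ = ((2 * q + 1 : ℕ) : ZMod m) * K := by rw [hq]
    _ = (q : ZMod m) * (((K : ℕ) : ZMod m) + K) + K := by push_cast; ring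
    _ = K := by rw [natCast_half_add_self hm, mul_zero, zero_add]

/-- `b + b ≠ 0` in `ℤ/2K` for `b ∉ {0, K}`. [folklore] -/
private theorem add_self_ne_zero_of_ne_half [NeZero m] (hm : m = 2 * K) {b : ZMod m} (hb0 : b ≠ 0) (hbK : b ≠ K) : b + b ≠ 0 := by
  intro h
  have hy0 : b.val ≠ 0 := fun e ↦ hb0 ((ZMod.val_eq_zero b).1 e)
  have hyK : b.val ≠ K := fun e ↦ hbK (by rw [← ZMod.natCast_zmod_val b, e])
  have hym : b.val < m := ZMod.val_lt b
  have hv := congrArg ZMod.val h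
  rw [ZMod.val_add, ZMod.val_zero] at hv
  have hdvd : m ∣ b.val + b.val := Nat.dvd_of_mod_eq_zero hv
  obtain ⟨c, hc⟩ := hdvd
  have hc1 : c = 1 := by
    rcases Nat.lt_or_ge c 2 with hc2 | hc2
    · interval_cases c
      · omega
      · rfl
    · nlinarith
  subst hc1
  omega

/-- **The norm computation of Lemma 1 (a)**: for `b ∉ {0, K}` in `ℤ/2K`, `⟨b⟩ + ⟨K⟩ + ⟨K + b⟩ + ⟨−2b⟩ = 2m`.
[cite: Shioda1982PicardFermat, Lemma 1 (a) p. 728] -/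
theorem norm_alpha [NeZero m] (hm : m = 2 * K) {b : ZMod m} (hb0 : b ≠ 0) (hbK : b ≠ K) :
    b.val + ((K : ℕ) : ZMod m).val + (((K : ℕ) : ZMod m) + b).val + (-(b + b)).val = 2 * m := by
  have hy0 : b.val ≠ 0 := fun e ↦ hb0 ((ZMod.val_eq_zero b).1 e)
  have hyK : b.val ≠ K := fun e ↦ hbK (by rw [← ZMod.natCast_zmod_val b, e])
  have hym : b.val < m := ZMod.val_lt b
  have hKb : (((K : ℕ) : ZMod m) + b).val = (K + b.val) % m := by rw [ZMod.val_add, val_natCast_half hm]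
  have hbb : (b + b).val = (b.val + b.val) % m := ZMod.val_add b b
  have hneg : (-(b + b)).val = m - (b + b).val := by
    rw [ZMod.neg_val, if_neg (add_self_ne_zero_of_ne_half hm hb0 hbK)]
  rw [val_natCast_half hm, hKb, hneg, hbb]
  rcases Nat.lt_or_ge b.val K with h | h
  · rw [Nat.mod_eq_of_lt (by omega : K + b.val < m), Nat.mod_eq_of_lt (by omega : b.val + b.val < m)]
    omega
  · have e1 : (K + b.val) % m = b.val - K := by
      rw [Nat.mod_eq_sub_mod (by omega), Nat.mod_eq_of_lt (by omega)]
      omega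
    have e2 : (b.val + b.val) % m = b.val + b.val - m := by
      rw [Nat.mod_eq_sub_mod (by omega), Nat.mod_eq_of_lt (by omega)]
    rw [e1, e2]
    omega

/-! ### Lemma 1 (a): `αᵢ ∈ 𝔅²ₘ` -/

/-- **[Shioda1982PicardFermat, Lemma 1 (a)], `αᵢ ∈ 𝔅²ₘ`**: for `m = 2K` and `a ∉ {0, K}` the quadruple `{a, K, K + a, 2K − 2a}`
(`= αᵢ = (i, m′+i, m−2i, m′)` for `a = i`) is a Hodge multiset. [cite: Shioda1982PicardFermat, Lemma 1 (a) p. 728]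
[cite: MeyerNeutsch1981Fermatquadrupel, (13) p. 53] -/
theorem isHodgeMultiset_alpha [NeZero m] (hm : m = 2 * K) {a : ZMod m} (ha0 : a ≠ 0) (haK : a ≠ K) :
    IsHodgeMultiset ({a, ((K : ℕ) : ZMod m), ((K : ℕ) : ZMod m) + a, 2 * ((K : ℕ) : ZMod m) - 2 * a} : Multiset (ZMod m)) := by
  have hKK := natCast_half_add_self hm
  have hK0 := natCast_half_ne_zero hm
  have h2a : 2 * ((K : ℕ) : ZMod m) - 2 * a = -(a + a) := by linear_combination hKK
  refine ⟨⟨?_, ?_⟩, fun t ↦ ?_⟩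
  · simp only [insert_eq_cons, mem_cons, mem_singleton]
    rintro x (rfl | rfl | rfl | rfl)
    · exact ha0
    · exact hK0
    · intro h
      apply haK
      linear_combination h - hKK
    · rw [h2a, neg_ne_zero]
      exact add_self_ne_zero_of_ne_half hm ha0 haK
  · simp only [insert_eq_cons, sum_cons, sum_singleton]
    linear_combination (2 : ZMod m) * hKK
  · -- the norm at the unit `t`: `b = t a ∉ {0, K}`
    have htK := unit_mul_natCast_half hm t
    have hb0 : (t : ZMod m) * a ≠ 0 := fun h ↦ ha0 ((Units.isUnit t).mul_right_eq_zero.mp h)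
    have hbK : (t : ZMod m) * a ≠ K := by
      intro h
      apply haK
      calc a = ((t⁻¹ : (ZMod m)ˣ) : ZMod m) * ((t : ZMod m) * a) := by rw [← mul_assoc, Units.inv_mul, one_mul]
        _ = K := by rw [h, unit_mul_natCast_half hm t⁻¹]
    have e2 : (t : ZMod m) * (((K : ℕ) : ZMod m) + a) = ((K : ℕ) : ZMod m) + (t : ZMod m) * a := by rw [mul_add, htK]
    have e3 : (t : ZMod m) * (2 * ((K : ℕ) : ZMod m) - 2 * a) = -((t : ZMod m) * a + (t : ZMod m) * a) := by
      rw [h2a]; ring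
    have key := norm_alpha hm hb0 hbK
    simp only [insert_eq_cons, map_cons, map_singleton, mNormSum_cons, card_cons, card_singleton, htK, e2, e3]
    simp only [mNormSum, map_singleton, sum_singleton]
    omega

/-! ### The instance `L₁ = α₁` (`stdOne`), even `m ≥ 6` -/

/-- **`L₁ = α₁ = (1, K, K+1, 2K−2)` is a Hodge quadruple** for even `m = 2K ≥ 6`. [cite: Shioda1982PicardFermat, Lemma 1 (a) p. 728]
[cite: MeyerNeutsch1981Fermatquadrupel, (13) p. 53] -/
theorem isHodgeMultiset_stdOne [NeZero m] (h2 : 2 ∣ m) (h6 : 6 ≤ m) : IsHodgeMultiset (stdOne m) := by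
  have hm : m = 2 * (m / 2) := (Nat.mul_div_cancel' h2).symm
  haveI : Fact (1 < m) := ⟨by omega⟩
  have h1K : (1 : ZMod m) ≠ ((m / 2 : ℕ) : ZMod m) := by
    intro h
    have h' := congrArg ZMod.val h
    rw [ZMod.val_one, val_natCast_half hm] at h'
    omega
  have h := isHodgeMultiset_alpha hm (a := 1) one_ne_zero h1K
  rw [mul_one] at h
  exact h

/-- `L₁` has four entries. [cite: MeyerNeutsch1981Fermatquadrupel, (13) p. 53] -/
theorem card_stdOne : card (stdOne m) = 4 := by
  simp [stdOne]

/-- `1 ∈ L₁`. [cite: MeyerNeutsch1981Fermatquadrupel, (13) p. 53] -/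
theorem one_mem_stdOne : (1 : ZMod m) ∈ stdOne m := by
  simp [stdOne]

/-- `−1 ∉ L₁` for even `m ≥ 6` (`−1 ≠ 1, K, K+1, −2`; the computation behind "`α₁` is indecomposable").
[cite: Shioda1982PicardFermat, Lemma 1 (a) p. 728] -/
theorem neg_one_not_mem_stdOne [NeZero m] (h2 : 2 ∣ m) (h6 : 6 ≤ m) : (-1 : ZMod m) ∉ stdOne m := by
  obtain ⟨K, rfl⟩ := h2
  have hK : 2 * K / 2 = K := by omega
  have nat_ne : ∀ n : ℕ, 0 < n → n < 2 * K → ((n : ℕ) : ZMod (2 * K)) ≠ 0 := fun n hn hlt h ↦ by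
    have := (ZMod.natCast_eq_zero_iff n (2 * K)).1 h
    exact absurd (Nat.le_of_dvd hn this) (by omega)
  simp only [stdOne, hK, insert_eq_cons, mem_cons, mem_singleton, not_or]
  refine ⟨fun h ↦ ?_, fun h ↦ ?_, fun h ↦ ?_, fun h ↦ ?_⟩
  · exact nat_ne 2 (by norm_num) (by omega) (by push_cast; linear_combination -h)
  · exact nat_ne (K + 1) (by omega) (by omega) (by push_cast; linear_combination -h)
  · exact nat_ne (K + 2) (by omega) (by omega) (by push_cast; linear_combination -h)
  · have hKK := natCast_half_add_self (m := 2 * K) (K := K) rfl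
    exact nat_ne 1 one_pos (by omega) (by push_cast; linear_combination h + hKK)

/-- **`L₁ = α₁` is indecomposable** for even `m ≥ 6`: it is not `{a, −a} + {b, −b}` (it contains `1` but not `−1`).
[cite: Shioda1982PicardFermat, §2 p. 726 (decomposable) and Lemma 1 (a) p. 728 (αᵢ indecomposable)] -/
theorem not_exists_eq_pairs_stdOne [NeZero m] (h2 : 2 ∣ m) (h6 : 6 ≤ m) :
    ¬ ∃ a b : ZMod m, stdOne m = {a, -a} + {b, -b} := by
  rintro ⟨a, b, hab⟩
  have h1 := one_mem_stdOne (m := m)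
  have hn1 := neg_one_not_mem_stdOne h2 h6
  rw [hab] at h1 hn1
  simp only [insert_eq_cons, mem_add, mem_cons, mem_singleton] at h1 hn1
  push Not at hn1
  obtain ⟨h1a, h1b⟩ := hn1
  rcases h1 with (rfl | h) | (rfl | h)
  · exact h1a.2 rfl
  · exact h1a.1 (by rw [h, neg_neg])
  · exact h1b.2 rfl
  · exact h1b.1 (by rw [h, neg_neg])

/-! ### Lemma 1 (b): `γ₁ = L₃ ∈ 𝔅²ₘ` via Aoki's `σ_{3,1}` -/

/-- `L₃ = γ₁ = (1, m″+1, 2m″+1, m−3)` is the multiset of Aoki's `σ_{3,1} = (1, 1+d, 1+2d, −3)`, `d = m/3` (for `3 ∣ m`), in the spelling of the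
tree's `isHodgeMultiset_pStandard`. [cite: Shioda1982PicardFermat, Lemma 1 (b) p. 728] [cite: MeyerNeutsch1981Fermatquadrupel, (15) p. 53] -/
theorem stdThree_eq_pStandard (h3 : 3 ∣ m) :
    stdThree m = (Multiset.range 3).map (fun i : ℕ ↦ (1 : ZMod m) + (i : ZMod m) * ((m / 3 : ℕ) : ZMod m)) +
      {-((3 : ZMod m) * 1)} := by
  have hd3 : (3 : ZMod m) * ((m / 3 : ℕ) : ZMod m) = 0 := by
    have h : ((3 * (m / 3) : ℕ) : ZMod m) = 0 := by rw [Nat.mul_div_cancel' h3, ZMod.natCast_self]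
    push_cast at h
    exact h
  have e4 : (3 : ZMod m) * ((m / 3 : ℕ) : ZMod m) - 3 = -((3 : ZMod m) * 1) := by rw [hd3]; ring
  unfold stdThree
  rw [e4]
  simp only [Multiset.range_succ, Multiset.range_zero, Multiset.map_cons, Multiset.map_zero, Multiset.cons_add, zero_add,
    insert_eq_cons, Nat.cast_ofNat, Nat.cast_one, Nat.cast_zero, one_mul, zero_mul, add_zero]
  rw [add_comm ((m / 3 : ℕ) : ZMod m) 1, add_comm (2 * ((m / 3 : ℕ) : ZMod m)) 1,
    Multiset.cons_swap (1 : ZMod m) (1 + ((m / 3 : ℕ) : ZMod m)),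
    Multiset.cons_swap (1 : ZMod m) (1 + 2 * ((m / 3 : ℕ) : ZMod m)),
    Multiset.cons_swap (1 + ((m / 3 : ℕ) : ZMod m)) (1 + 2 * ((m / 3 : ℕ) : ZMod m))]

/-- **[Shioda1982PicardFermat, Lemma 1 (b)], `γ₁ ∈ 𝔅²ₘ`**: for `3 ∣ m`, `m > 3`, `L₃ = γ₁ = (1, m″+1, 2m″+1, m−3)` is a Hodge quadruple
(Aoki's `σ_{3,1}`, Hodge by `isHodgeMultiset_pStandard`). [cite: Shioda1982PicardFermat, Lemma 1 (b) p. 728] [cite: Aoki1983, §5 Prop. 5.1 (p. 36)] -/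
theorem isHodgeMultiset_stdThree [NeZero m] (h3 : 3 ∣ m) (hm : 3 < m) : IsHodgeMultiset (stdThree m) := by
  rw [stdThree_eq_pStandard h3]
  refine isHodgeMultiset_pStandard (p := 3) (r := 1) rfl h3 (a := 1) ?_
  rw [mul_one]
  intro h
  have h' : ((3 : ℕ) : ZMod m) = 0 := by exact_mod_cast h
  have hdvd := (ZMod.natCast_eq_zero_iff _ _).1 h'
  exact absurd (Nat.le_of_dvd (by norm_num) hdvd) (by omega)

/-! ### Lemma 1 (a): `βᵢ ∈ 𝔅²ₘ` (appended 2026-08-20, cell `pub-hfermat` lit-g13) -/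

/-- **[Shioda1982PicardFermat, Lemma 1 (a)], `βᵢ ∈ 𝔅²ₘ`**: for `m = 2K` and `a ∈ ℤ/m` with `a ∉ {0, K}`, `2a ≠ K`, the quadruple
`{a, K + a, K + 2a, −4a} = βᵢ = (i, m′+i, m′+2i, m−4i)` (for `a = i`; Shioda's second spelling `(i, m′+i, 2i−m′, 2m−4i)` for `i > m′/2` is the
same residue quadruple) is a Hodge multiset. PROOF by cancellation from part `αᵢ`: as multisets `αₐ + α₂ₐ = {K, K} + {2a, −2a} + βₐ`
(`2K − 2a = −2a`, `−K = K`), the left side is Hodge (`isHodgeMultiset_alpha` at `a` and at `2a ∉ {0, K}`) and so are the two pairs, hence `βₐ` is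
Hodge (`IsHodgeMultiset.of_add_left`: Shioda's equations (2) are additive). [cite: Shioda1982PicardFermat, Lemma 1 (a) p. 728]
[cite: MeyerNeutsch1981Fermatquadrupel, (14) p. 53] -/
theorem isHodgeMultiset_beta [NeZero m] (hm : m = 2 * K) {a : ZMod m} (ha0 : a ≠ 0) (haK : a ≠ K) (h2aK : 2 * a ≠ K) :
    IsHodgeMultiset ({a, ((K : ℕ) : ZMod m) + a, ((K : ℕ) : ZMod m) + 2 * a, -(4 * a)} : Multiset (ZMod m)) := by
  have hKK := natCast_half_add_self hm
  have hK0 := natCast_half_ne_zero hm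
  have h2a0 : (2 : ZMod m) * a ≠ 0 := by
    rw [two_mul]
    exact add_self_ne_zero_of_ne_half hm ha0 haK
  have hα₁ := isHodgeMultiset_alpha hm ha0 haK
  have hα₂ := isHodgeMultiset_alpha hm h2a0 h2aK
  have hP : IsHodgeMultiset (({((K : ℕ) : ZMod m), -((K : ℕ) : ZMod m)} : Multiset (ZMod m)) + {2 * a, -(2 * a)}) :=
    (IsHodgeMultiset.pair hK0).add (IsHodgeMultiset.pair h2a0)
  have hsum := hα₁.add hα₂
  have e1 : 2 * ((K : ℕ) : ZMod m) - 2 * a = -(2 * a) := by linear_combination hKK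
  have e2 : 2 * ((K : ℕ) : ZMod m) - 2 * (2 * a) = -(4 * a) := by linear_combination hKK
  have e3 : -((K : ℕ) : ZMod m) = ((K : ℕ) : ZMod m) := by linear_combination -hKK
  rw [e1, e2] at hsum
  rw [e3] at hP
  have e : ({a, ((K : ℕ) : ZMod m), ((K : ℕ) : ZMod m) + a, -(2 * a)} : Multiset (ZMod m)) +
      {2 * a, ((K : ℕ) : ZMod m), ((K : ℕ) : ZMod m) + 2 * a, -(4 * a)} =
      (({((K : ℕ) : ZMod m), ((K : ℕ) : ZMod m)} : Multiset (ZMod m)) + {2 * a, -(2 * a)}) +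
        {a, ((K : ℕ) : ZMod m) + a, ((K : ℕ) : ZMod m) + 2 * a, -(4 * a)} := by
    simp only [insert_eq_cons, ← singleton_add]
    abel
  rw [e] at hsum
  exact hsum.of_add_left hP

/-- **`L₂ = β₁ = (1, K+1, K+2, 2K−4)` is a Hodge quadruple** for even `m = 2K ≥ 6` (`βᵢ` at `i = 1`: `1 ∉ {0, K}`, `2 ≠ K`).
[cite: Shioda1982PicardFermat, Lemma 1 (a) p. 728] [cite: MeyerNeutsch1981Fermatquadrupel, (14) p. 53] -/
theorem isHodgeMultiset_stdTwo [NeZero m] (h2 : 2 ∣ m) (h6 : 6 ≤ m) : IsHodgeMultiset (stdTwo m) := by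
  have hm : m = 2 * (m / 2) := (Nat.mul_div_cancel' h2).symm
  haveI : Fact (1 < m) := ⟨by omega⟩
  have hKK := natCast_half_add_self hm
  have h1K : (1 : ZMod m) ≠ ((m / 2 : ℕ) : ZMod m) := by
    intro h
    have h' := congrArg ZMod.val h
    rw [ZMod.val_one, val_natCast_half hm] at h'
    omega
  have h2K : (2 : ZMod m) * 1 ≠ ((m / 2 : ℕ) : ZMod m) := by
    intro h
    have h' := congrArg ZMod.val h
    rw [mul_one, val_natCast_half hm, show (2 : ZMod m) = ((2 : ℕ) : ZMod m) by norm_cast, ZMod.val_natCast,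
      Nat.mod_eq_of_lt (by omega)] at h'
    omega
  have h := isHodgeMultiset_beta hm (a := 1) one_ne_zero h1K h2K
  have e4 : 2 * ((m / 2 : ℕ) : ZMod m) - 4 = -(4 * 1) := by linear_combination hKK
  unfold stdTwo
  rw [e4, show ((m / 2 : ℕ) : ZMod m) + 2 = ((m / 2 : ℕ) : ZMod m) + 2 * 1 by rw [mul_one]]
  exact h

end Literature.AlgebraicGeometry.Shioda1982
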